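import Summits.CriticalPhenomena.PercolationContinuityZ3.Theorems.PercNearOneGluingNoHeavyLowerTailCubicThreePointGluingCells
import Summits.CriticalPhenomena.PercolationContinuityZ3.Theorems.PercNearOneGluingNoHeavyLowerTailCubicThreePointSeriesParallel
import Mathlib.Tactic.Ring
import Mathlib.Tactic.Linarith
import Mathlib.Tactic.LinearCombination
import HarnessLib

/-!
# `NoHeavyLowerTail` (stmt-CriticalPhenomena-4575) — decoupling across a vertex separator, part 2c:
# the three-point cells of an arbitrary arm glued at a cut vertex are the MEET of the far piece's cells with a pendant-arm law

Support file (prover prim-sahi-p2, SAHI cell P2; `--supports stmt-CriticalPhenomena-4575`).  No definitions, no named facts, no sorries.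
Setting of part 2a (`…CubicThreePointGluingCells`): piece 1 `(D₁, K₁)` is an ARBITRARY network containing `a` and the cut vertex `h` and
avoiding `b, c`; piece 2 `(D₂, K₂)` contains `h, b, c` and avoids `a`; the pieces' edges meet only in `h` (`hsep`); `a ≠ b, c`.  The arm enters
only through `α = PrW D₁ p (evT K₁ a h h) = P(a ↔ h in piece 1)` (the cell `evT K₁ a h h` is the event `a ↔ h`).
* pointwise: `pendant_R_ab/ac/bc` (part 1's `pendant_ab`, `pendant_bc`), `ind_pendant_T/U₁/U₂/U₃/Q`;
* summed: **`PrW_pendant_T`** `t = α T'`, **`PrW_pendant_U₁/U₂`** `uᵢ = α vᵢ'`, **`PrW_pendant_U₃`** `u₃ = v₃' + (1−α) T'`,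
  **`PrW_pendant_Q`** `q = Q' + (1−α)(v₁' + v₂')` in terms of the cells `(Q', v', T')` of `(h, b, c)` in piece 2 — the meet with the
  pendant-arm law, `SPLaw.meet _ (SPLaw.arm₃ _)` of `…CubicThreePointSeriesParallel` (= `…TerminalClosure`'s pendant move with a two-terminal
  blob in place of an edge), now REALIZED by gluing graphs;
* **`splaw_pendant`** — at the level of kcluster's class `SPLaw`: hanging an arbitrary two-terminal arm at a cut vertex of a system whose law is
  series–parallel yields a series–parallel law (hence `AG ≥ 0`, `max(Ha,Hb) ≥ 0`, SHK3⁺ = Sahi `E₃ ≥ 0` on the pairwise separations, by `SPLaw.sharp`/`SPLaw.F_nonneg`).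
[cite: Grimmett1999, §2.2 (product measure: independence of disjoint edge sets)]; [cite: GladkovZimin2024HK, §4 (block decomposition)]
-/

noncomputable section

namespace Summit.CriticalPhenomena.PercolationContinuityZ3.Theorems

namespace TerminalGluing

open Finset SimpleGraph Literature.Probability.Percolation Literature.Probability.Percolation.DecisionTree CubicThreePointStep
open CubicThreePointTerminal CubicThreePointJoin

variable {V : Type*} [DecidableEq V]

/-! ### PENDANT: an arbitrary `a–h` network glued at the cut vertex `h` to a network containing `h, b, c` -/

section Pendant

variable {D₁ D₂ K₁ K₂ : Finset (Sym2 V)} {a b c h : V}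
  (hsep : ∀ v : V, ∀ e₁ ∈ D₁ ∪ K₁, ∀ e₂ ∈ D₂ ∪ K₂, v ∈ e₁ → v ∈ e₂ → v = h)
  (ha : ∀ e ∈ D₂ ∪ K₂, a ∉ e) (hb : ∀ e ∈ D₁ ∪ K₁, b ∉ e) (hc : ∀ e ∈ D₁ ∪ K₁, c ∉ e) (hab : a ≠ b) (hac : a ≠ c)
  {S₁ S₂ : Finset (Sym2 V)} (hS₁ : S₁ ⊆ D₁) (hS₂ : S₂ ⊆ D₂)
include hsep hS₁ hS₂

/-- The two piece graphs of a configuration share only `h`. [folklore] -/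
theorem pendant_hT (v u u' : V) (h1 : (fromEdgeSet (↑(S₁ ∪ K₁) : Set (Sym2 V))).Adj v u)
    (h2 : (fromEdgeSet (↑(S₂ ∪ K₂) : Set (Sym2 V))).Adj v u') : v = h := by
  obtain ⟨e₁, he₁, hv₁, _⟩ := adj_mem_edge hS₁ h1
  obtain ⟨e₂, he₂, hv₂, _⟩ := adj_mem_edge hS₂ h2
  exact hsep v e₁ he₁ e₂ he₂ hv₁ hv₂

section
include ha hb hab
/-- `a ↔ b` in the glued configuration iff `a ↔ h` in the arm and `h ↔ b` in piece 2. [folklore] -/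
theorem pendant_R_ab : R (K₁ ∪ K₂) (S₁ ∪ S₂) a b ↔ R K₁ S₁ a h ∧ R K₂ S₂ h b := by
  rw [R_union_iff]
  exact pendant_ab (pendant_hT hsep hS₁ hS₂) (not_adj_of_avoids hS₂ ha) (not_adj_of_avoids hS₁ hb) hab
end

section
include ha hc hac
/-- `a ↔ c` in the glued configuration iff `a ↔ h` in the arm and `h ↔ c` in piece 2. [folklore] -/
theorem pendant_R_ac : R (K₁ ∪ K₂) (S₁ ∪ S₂) a c ↔ R K₁ S₁ a h ∧ R K₂ S₂ h c := by
  rw [R_union_iff]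
  exact pendant_ab (pendant_hT hsep hS₁ hS₂) (not_adj_of_avoids hS₂ ha) (not_adj_of_avoids hS₁ hc) hac
end

section
include hb hc
/-- `b ↔ c` in the glued configuration iff `b ↔ c` in piece 2. [folklore] -/
theorem pendant_R_bc : R (K₁ ∪ K₂) (S₁ ∪ S₂) b c ↔ R K₂ S₂ b c := by
  rw [R_union_iff]
  exact pendant_bc (pendant_hT hsep hS₁ hS₂) (not_adj_of_avoids hS₁ hb) (not_adj_of_avoids hS₁ hc)
end

include ha hb hc hab hac

/-- **Pendant, cell `abc`** (pointwise): `a ↔ h` in the arm and `h, b, c` joined in piece 2. [folklore] -/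
theorem ind_pendant_T :
    ind (evT (K₁ ∪ K₂) a b c) (S₁ ∪ S₂) = ind (evT K₁ a h h) S₁ * ind (evT K₂ h b c) S₂ := by
  have e1 := pendant_R_ab hsep ha hb hab hS₁ hS₂
  have e2 := pendant_R_ac hsep ha hc hac hS₁ hS₂
  by_cases hh : S₁ ∈ evT K₁ a h h ∧ S₂ ∈ evT K₂ h b c
  · obtain ⟨⟨hah, _⟩, ⟨hhb, hhc⟩⟩ := hh
    rw [ind_of_mem (show S₁ ∪ S₂ ∈ evT (K₁ ∪ K₂) a b c from ⟨e1.2 ⟨hah, hhb⟩, e2.2 ⟨hah, hhc⟩⟩),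
      ind_of_mem (show S₁ ∈ evT K₁ a h h from ⟨hah, hah⟩), ind_of_mem (show S₂ ∈ evT K₂ h b c from ⟨hhb, hhc⟩), mul_one]
  · rw [ind_mul_eq_zero_of_not_and hh]
    refine ind_of_not_mem fun ⟨hab', hac'⟩ => hh ?_
    exact ⟨⟨(e1.1 hab').1, (e1.1 hab').1⟩, ⟨(e1.1 hab').2, (e2.1 hac').2⟩⟩

/-- **Pendant, cell `ab|c`** (pointwise). [folklore] -/
theorem ind_pendant_U₁ :
    ind (evU₁ (K₁ ∪ K₂) a b c) (S₁ ∪ S₂) = ind (evT K₁ a h h) S₁ * ind (evU₁ K₂ h b c) S₂ := by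
  have e1 := pendant_R_ab hsep ha hb hab hS₁ hS₂
  have e2 := pendant_R_ac hsep ha hc hac hS₁ hS₂
  by_cases hh : S₁ ∈ evT K₁ a h h ∧ S₂ ∈ evU₁ K₂ h b c
  · obtain ⟨⟨hah, _⟩, ⟨hhb, hhc⟩⟩ := hh
    rw [ind_of_mem (show S₁ ∪ S₂ ∈ evU₁ (K₁ ∪ K₂) a b c from ⟨e1.2 ⟨hah, hhb⟩, fun h' => hhc (e2.1 h').2⟩),
      ind_of_mem (show S₁ ∈ evT K₁ a h h from ⟨hah, hah⟩), ind_of_mem (show S₂ ∈ evU₁ K₂ h b c from ⟨hhb, hhc⟩), mul_one]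
  · rw [ind_mul_eq_zero_of_not_and hh]
    refine ind_of_not_mem fun ⟨hab', hac'⟩ => hh ?_
    exact ⟨⟨(e1.1 hab').1, (e1.1 hab').1⟩, ⟨(e1.1 hab').2, fun h' => hac' (e2.2 ⟨(e1.1 hab').1, h'⟩)⟩⟩

/-- **Pendant, cell `ac|b`** (pointwise). [folklore] -/
theorem ind_pendant_U₂ :
    ind (evU₂ (K₁ ∪ K₂) a b c) (S₁ ∪ S₂) = ind (evT K₁ a h h) S₁ * ind (evU₂ K₂ h b c) S₂ := by
  have e1 := pendant_R_ab hsep ha hb hab hS₁ hS₂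
  have e2 := pendant_R_ac hsep ha hc hac hS₁ hS₂
  by_cases hh : S₁ ∈ evT K₁ a h h ∧ S₂ ∈ evU₂ K₂ h b c
  · obtain ⟨⟨hah, _⟩, ⟨hhc, hhb⟩⟩ := hh
    rw [ind_of_mem (show S₁ ∪ S₂ ∈ evU₂ (K₁ ∪ K₂) a b c from ⟨e2.2 ⟨hah, hhc⟩, fun h' => hhb (e1.1 h').2⟩),
      ind_of_mem (show S₁ ∈ evT K₁ a h h from ⟨hah, hah⟩), ind_of_mem (show S₂ ∈ evU₂ K₂ h b c from ⟨hhc, hhb⟩), mul_one]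
  · rw [ind_mul_eq_zero_of_not_and hh]
    refine ind_of_not_mem fun ⟨hac', hab'⟩ => hh ?_
    exact ⟨⟨(e2.1 hac').1, (e2.1 hac').1⟩, ⟨(e2.1 hac').2, fun h' => hab' (e1.2 ⟨(e2.1 hac').1, h'⟩)⟩⟩

omit hac in
/-- **Pendant, cell `bc|a`** (pointwise): `b ↔ c` in piece 2 with `h` off their cluster, or with `h` on it and the arm closed. [folklore] -/
theorem ind_pendant_U₃ :
    ind (evU₃ (K₁ ∪ K₂) a b c) (S₁ ∪ S₂) =
      ind (evU₃ K₂ h b c) S₂ + ind (evT K₂ h b c) S₂ * (1 - ind (evT K₁ a h h) S₁) := by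
  have e1 := pendant_R_ab hsep ha hb hab hS₁ hS₂
  have e3 := pendant_R_bc hsep hb hc hS₁ hS₂
  by_cases hbc : R K₂ S₂ b c
  · by_cases hhb : R K₂ S₂ h b
    · have hT' : S₂ ∈ evT K₂ h b c := ⟨hhb, hhb.trans hbc⟩
      rw [ind_of_not_mem (fun h' : S₂ ∈ evU₃ K₂ h b c => h'.2 hhb), ind_of_mem hT']
      by_cases hah : R K₁ S₁ a h
      · rw [ind_of_mem (show S₁ ∈ evT K₁ a h h from ⟨hah, hah⟩),
          ind_of_not_mem (fun h' : S₁ ∪ S₂ ∈ evU₃ (K₁ ∪ K₂) a b c => h'.2 (e1.2 ⟨hah, hhb⟩))]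
        ring
      · rw [ind_of_not_mem (fun h' : S₁ ∈ evT K₁ a h h => hah h'.1),
          ind_of_mem (show S₁ ∪ S₂ ∈ evU₃ (K₁ ∪ K₂) a b c from ⟨e3.2 hbc, fun h' => hah (e1.1 h').1⟩)]
        ring
    · rw [ind_of_mem (show S₂ ∈ evU₃ K₂ h b c from ⟨hbc, hhb⟩), ind_of_not_mem (fun h' : S₂ ∈ evT K₂ h b c => hhb h'.1),
        ind_of_mem (show S₁ ∪ S₂ ∈ evU₃ (K₁ ∪ K₂) a b c from ⟨e3.2 hbc, fun h' => hhb (e1.1 h').2⟩)]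
      ring
  · rw [ind_of_not_mem (fun h' : S₁ ∪ S₂ ∈ evU₃ (K₁ ∪ K₂) a b c => hbc (e3.1 h'.1)),
      ind_of_not_mem (fun h' : S₂ ∈ evU₃ K₂ h b c => hbc h'.1),
      ind_of_not_mem (fun h' : S₂ ∈ evT K₂ h b c => hbc (h'.1.symm.trans h'.2))]
    ring

/-- **Pendant, cell `a|b|c`** (pointwise). [folklore] -/
theorem ind_pendant_Q :
    ind (evQ (K₁ ∪ K₂) a b c) (S₁ ∪ S₂) =
      ind (evQ K₂ h b c) S₂ + (ind (evU₁ K₂ h b c) S₂ + ind (evU₂ K₂ h b c) S₂) * (1 - ind (evT K₁ a h h) S₁) := by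
  have e1 := pendant_R_ab hsep ha hb hab hS₁ hS₂
  have e2 := pendant_R_ac hsep ha hc hac hS₁ hS₂
  have e3 := pendant_R_bc hsep hb hc hS₁ hS₂
  by_cases hbc : R K₂ S₂ b c
  · -- `b ↔ c`: neither side is in an `a|b|c`-type cell
    rw [ind_of_not_mem (fun h' : S₁ ∪ S₂ ∈ evQ (K₁ ∪ K₂) a b c => h'.2.2 (e3.2 hbc)),
      ind_of_not_mem (fun h' : S₂ ∈ evQ K₂ h b c => h'.2.2 hbc),
      ind_of_not_mem (fun h' : S₂ ∈ evU₁ K₂ h b c => h'.2 (h'.1.trans hbc)),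
      ind_of_not_mem (fun h' : S₂ ∈ evU₂ K₂ h b c => h'.2 (h'.1.trans hbc.symm))]
    ring
  · have hbc' : ¬ R (K₁ ∪ K₂) (S₁ ∪ S₂) b c := fun h' => hbc (e3.1 h')
    by_cases hhb : R K₂ S₂ h b
    · have hhc : ¬ R K₂ S₂ h c := fun h' => hbc (hhb.symm.trans h')
      rw [ind_of_not_mem (fun h' : S₂ ∈ evQ K₂ h b c => h'.1 hhb), ind_of_mem (show S₂ ∈ evU₁ K₂ h b c from ⟨hhb, hhc⟩),
        ind_of_not_mem (fun h' : S₂ ∈ evU₂ K₂ h b c => h'.2 hhb)]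
      by_cases hah : R K₁ S₁ a h
      · rw [ind_of_mem (show S₁ ∈ evT K₁ a h h from ⟨hah, hah⟩),
          ind_of_not_mem (fun h' : S₁ ∪ S₂ ∈ evQ (K₁ ∪ K₂) a b c => h'.1 (e1.2 ⟨hah, hhb⟩))]
        ring
      · rw [ind_of_not_mem (fun h' : S₁ ∈ evT K₁ a h h => hah h'.1),
          ind_of_mem (show S₁ ∪ S₂ ∈ evQ (K₁ ∪ K₂) a b c from
            ⟨fun h' => hah (e1.1 h').1, fun h' => hah (e2.1 h').1, hbc'⟩)]
        ring
    · by_cases hhc : R K₂ S₂ h c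
      · rw [ind_of_not_mem (fun h' : S₂ ∈ evQ K₂ h b c => h'.2.1 hhc),
          ind_of_not_mem (fun h' : S₂ ∈ evU₁ K₂ h b c => hhb h'.1),
          ind_of_mem (show S₂ ∈ evU₂ K₂ h b c from ⟨hhc, hhb⟩)]
        by_cases hah : R K₁ S₁ a h
        · rw [ind_of_mem (show S₁ ∈ evT K₁ a h h from ⟨hah, hah⟩),
            ind_of_not_mem (fun h' : S₁ ∪ S₂ ∈ evQ (K₁ ∪ K₂) a b c => h'.2.1 (e2.2 ⟨hah, hhc⟩))]
          ring
        · rw [ind_of_not_mem (fun h' : S₁ ∈ evT K₁ a h h => hah h'.1),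
            ind_of_mem (show S₁ ∪ S₂ ∈ evQ (K₁ ∪ K₂) a b c from
              ⟨fun h' => hah (e1.1 h').1, fun h' => hah (e2.1 h').1, hbc'⟩)]
          ring
      · rw [ind_of_mem (show S₂ ∈ evQ K₂ h b c from ⟨hhb, hhc, hbc⟩),
          ind_of_not_mem (fun h' : S₂ ∈ evU₁ K₂ h b c => hhb h'.1),
          ind_of_not_mem (fun h' : S₂ ∈ evU₂ K₂ h b c => hhc h'.1),
          ind_of_mem (show S₁ ∪ S₂ ∈ evQ (K₁ ∪ K₂) a b c from
            ⟨fun h' => hhb (e1.1 h').2, fun h' => hhc (e2.1 h').2, hbc'⟩)]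
        ring

end Pendant

/-! ### PENDANT: the masses -/

section PendantMasses

variable {D₁ D₂ K₁ K₂ : Finset (Sym2 V)} (p : Sym2 V → ℝ) {a b c h : V} (hD : Disjoint D₁ D₂)
  (hsep : ∀ v : V, ∀ e₁ ∈ D₁ ∪ K₁, ∀ e₂ ∈ D₂ ∪ K₂, v ∈ e₁ → v ∈ e₂ → v = h)
  (ha : ∀ e ∈ D₂ ∪ K₂, a ∉ e) (hb : ∀ e ∈ D₁ ∪ K₁, b ∉ e) (hc : ∀ e ∈ D₁ ∪ K₁, c ∉ e) (hab : a ≠ b) (hac : a ≠ c)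
include hD hsep ha hb hc hab hac

/-- **Pendant law, cell `abc`**: `t = α · T'`, `α = P(a ↔ h in the arm)`. [folklore] -/
theorem PrW_pendant_T :
    PrW (D₁ ∪ D₂) p (evT (K₁ ∪ K₂) a b c) = PrW D₁ p (evT K₁ a h h) * PrW D₂ p (evT K₂ h b c) :=
  PrW_union_of_pointwise_mul p hD fun _ _ hS₁ hS₂ =>
    ind_pendant_T hsep ha hb hc hab hac hS₁ hS₂

/-- **Pendant law, cell `ab|c`**: `u₁ = α · v₁'`. [folklore] -/
theorem PrW_pendant_U₁ :
    PrW (D₁ ∪ D₂) p (evU₁ (K₁ ∪ K₂) a b c) = PrW D₁ p (evT K₁ a h h) * PrW D₂ p (evU₁ K₂ h b c) :=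
  PrW_union_of_pointwise_mul p hD fun _ _ hS₁ hS₂ =>
    ind_pendant_U₁ hsep ha hb hc hab hac hS₁ hS₂

/-- **Pendant law, cell `ac|b`**: `u₂ = α · v₂'`. [folklore] -/
theorem PrW_pendant_U₂ :
    PrW (D₁ ∪ D₂) p (evU₂ (K₁ ∪ K₂) a b c) = PrW D₁ p (evT K₁ a h h) * PrW D₂ p (evU₂ K₂ h b c) :=
  PrW_union_of_pointwise_mul p hD fun _ _ hS₁ hS₂ =>
    ind_pendant_U₂ hsep ha hb hc hab hac hS₁ hS₂

omit hac in
/-- **Pendant law, cell `bc|a`**: `u₃ = v₃' + (1 − α) · T'`. [folklore] -/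
theorem PrW_pendant_U₃ :
    PrW (D₁ ∪ D₂) p (evU₃ (K₁ ∪ K₂) a b c) =
      PrW D₂ p (evU₃ K₂ h b c) + (1 - PrW D₁ p (evT K₁ a h h)) * PrW D₂ p (evT K₂ h b c) := by
  rw [PrW_eq_ED, ED_union D₁ D₂ hD, PrW_eq_ED, PrW_eq_ED, PrW_eq_ED]
  have h1 : ED D₁ p (fun s => ED D₂ p fun T => ind (evU₃ (K₁ ∪ K₂) a b c) (s ∪ T)) =
      ED D₁ p (fun s => ED D₂ p (ind (evU₃ K₂ h b c)) + (ED D₂ p (ind (evT K₂ h b c)) +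
        (- ED D₂ p (ind (evT K₂ h b c))) * ind (evT K₁ a h h) s)) := by
    refine ED_congr_sub D₁ p fun S₁ hS₁ => ?_
    rw [ED_congr_sub D₂ p (fun S₂ hS₂ => ind_pendant_U₃ hsep ha hb hc hab hS₁ hS₂)]
    rw [show (fun S₂ => ind (evU₃ K₂ h b c) S₂ + ind (evT K₂ h b c) S₂ * (1 - ind (evT K₁ a h h) S₁)) =
        fun S₂ => ind (evU₃ K₂ h b c) S₂ + (1 - ind (evT K₁ a h h) S₁) * ind (evT K₂ h b c) S₂ from
        funext fun S₂ => by ring]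
    rw [ED_add, ED_mul_left]
    ring
  rw [h1, ED_add, ED_add, ED_mul_left, ED_const', ED_const']
  ring

/-- **Pendant law, cell `a|b|c`**: `q = Q' + (1 − α) · (v₁' + v₂')`. [folklore] -/
theorem PrW_pendant_Q :
    PrW (D₁ ∪ D₂) p (evQ (K₁ ∪ K₂) a b c) =
      PrW D₂ p (evQ K₂ h b c) + (1 - PrW D₁ p (evT K₁ a h h)) * (PrW D₂ p (evU₁ K₂ h b c) + PrW D₂ p (evU₂ K₂ h b c)) := by
  rw [PrW_eq_ED, ED_union D₁ D₂ hD, PrW_eq_ED, PrW_eq_ED, PrW_eq_ED, PrW_eq_ED]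
  have h1 : ED D₁ p (fun s => ED D₂ p fun T => ind (evQ (K₁ ∪ K₂) a b c) (s ∪ T)) =
      ED D₁ p (fun s => (ED D₂ p (ind (evQ K₂ h b c)) + (ED D₂ p (ind (evU₁ K₂ h b c)) + ED D₂ p (ind (evU₂ K₂ h b c)))) +
        (-(ED D₂ p (ind (evU₁ K₂ h b c)) + ED D₂ p (ind (evU₂ K₂ h b c)))) * ind (evT K₁ a h h) s) := by
    refine ED_congr_sub D₁ p fun S₁ hS₁ => ?_
    rw [ED_congr_sub D₂ p (fun S₂ hS₂ => ind_pendant_Q hsep ha hb hc hab hac hS₁ hS₂)]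
    rw [show (fun S₂ => ind (evQ K₂ h b c) S₂ +
          (ind (evU₁ K₂ h b c) S₂ + ind (evU₂ K₂ h b c) S₂) * (1 - ind (evT K₁ a h h) S₁)) =
        fun S₂ => ind (evQ K₂ h b c) S₂ + ((1 - ind (evT K₁ a h h) S₁) * ind (evU₁ K₂ h b c) S₂ +
          (1 - ind (evT K₁ a h h) S₁) * ind (evU₂ K₂ h b c) S₂) from funext fun S₂ => by ring]
    rw [ED_add, ED_add, ED_mul_left, ED_mul_left]
    ring
  rw [h1, ED_add, ED_mul_left, ED_const']
  ring

end PendantMasses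

/-! ### The pendant move at the level of `SPLaw` -/

section PendantMove

variable {D₁ D₂ K₁ K₂ : Finset (Sym2 V)} (p : Sym2 V → ℝ) {a b c h : V} (hD : Disjoint D₁ D₂)
include hD

/-- **Pendant composition of graphs ⇒ meet with an arm law.**  An arbitrary `a–h` network (avoiding `b, c`) glued at the cut vertex `h` to a
system on `(h, b, c)` (avoiding `a`) with a series–parallel law yields a series–parallel law on `(a, b, c)`. [folklore] -/
theorem splaw_pendant (hp0 : ∀ i, 0 ≤ p i) (hp1 : ∀ i, p i ≤ 1)
    (hsep : ∀ v : V, ∀ e₁ ∈ D₁ ∪ K₁, ∀ e₂ ∈ D₂ ∪ K₂, v ∈ e₁ → v ∈ e₂ → v = h)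
    (ha : ∀ e ∈ D₂ ∪ K₂, a ∉ e) (hb : ∀ e ∈ D₁ ∪ K₁, b ∉ e) (hc : ∀ e ∈ D₁ ∪ K₁, c ∉ e) (hab : a ≠ b) (hac : a ≠ c)
    (h₂ : SPLaw (PrW D₂ p (evQ K₂ h b c)) (PrW D₂ p (evU₁ K₂ h b c)) (PrW D₂ p (evU₂ K₂ h b c)) (PrW D₂ p (evU₃ K₂ h b c))
      (PrW D₂ p (evT K₂ h b c))) :
    SPLaw (PrW (D₁ ∪ D₂) p (evQ (K₁ ∪ K₂) a b c)) (PrW (D₁ ∪ D₂) p (evU₁ (K₁ ∪ K₂) a b c))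
      (PrW (D₁ ∪ D₂) p (evU₂ (K₁ ∪ K₂) a b c)) (PrW (D₁ ∪ D₂) p (evU₃ (K₁ ∪ K₂) a b c))
      (PrW (D₁ ∪ D₂) p (evT (K₁ ∪ K₂) a b c)) := by
  have hα₀ : 0 ≤ PrW D₁ p (evT K₁ a h h) := PrW_nonneg D₁ hp0 hp1 _
  have hα₁ : PrW D₁ p (evT K₁ a h h) ≤ 1 := by
    rw [← PrW_univ D₁ p]
    exact PrW_mono D₁ hp0 hp1 fun S _ _ => Set.mem_univ S
  have hm := SPLaw.meet h₂ (SPLaw.arm₃ hα₀ hα₁)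
  rw [PrW_pendant_Q p hD hsep ha hb hc hab hac, PrW_pendant_U₁ p hD hsep ha hb hc hab hac,
    PrW_pendant_U₂ p hD hsep ha hb hc hab hac, PrW_pendant_U₃ p hD hsep ha hb hc hab, PrW_pendant_T p hD hsep ha hb hc hab hac]
  convert hm using 1 <;> ring

end PendantMove

end TerminalGluing

end Summit.CriticalPhenomena.PercolationContinuityZ3.Theorems
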